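import Literature.NumberTheory.IwasawaTheory.ClassicalMuVanishesQuadraticAscentSqrt
import Literature.NumberTheory.EllipticCurves.ZpExtensionRestrictTwoSqrtTwo
import Literature.NumberTheory.EllipticCurves.ZpExtensionRestrictProofs
import Literature.NumberTheory.EllipticCurves.ZpExtensionRestrictCyclotomic
import Literature.NumberTheory.IwasawaTheory.ClassicalMuVanishesNormRelationTower
import HarnessLib

/-!
# Iwasawa's `μ₂ = 0` ascends `K(√m)/K` over `ℚ` for `K` of odd degree with at most one real place and `K(√m)` totally complex —
# the degree and the two `κ ∘ res`-surjectivity hypotheses discharged (proved, no definition, no named fact)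

`Proofs`-style file (theorems only) in topic `NumberTheory/IwasawaTheory` (namespace `Literature.NumberTheory.IwasawaTheory`), written by the
prover seat `cruxlead-stmt-BirchSwinnertonDyer-19573-w2` GEN 7 (cell `bsd-2adic`; `--supports` stmt-BirchSwinnertonDyer-19573). Module (E-d) of the
seat's «Iwasawa ℓ = 2 ascent with real places», on top of `classicalMuVanishes_restrict_rat_of_sq_eq`:

* `finrank_eq_two_of_sq_eq_of_isTotallyComplex` — `K' = K(x)`, `x² ∈ K`, `K'` totally complex, `[K : ℚ]` odd ⟹ `[K' : K] = 2`
  (`≤ 2` by the minimal polynomial; `≠ 1` as `K` has a real place — odd degree — and `K'` has none).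
* `surjective_comp_absGaloisRestrict_of_sq_eq_of_isTotallyComplex` — same data, `κ` cyclotomic: `κ ∘ res_{K'}` is onto. By the tree's
  `surjective_comp_absGaloisRestrict_or_exists_sq_eq_two` (`4 ∤ [K' : ℚ] = 2·odd`) the alternative is `√2 ∈ K'`; `√2 ∈ K` contradicts
  `[K : ℚ]` odd, and `√2 ∈ K' ∖ K` makes `K' = K(√2)`, which has a real place above the real place of `K`.
* **`classicalMu_of_sq_eq_of_odd_finrank`** — `κ` cyclotomic over `ℚ`; `K ⊆ K'` number fields, `[K : ℚ]` odd, `K` with at most one real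
  embedding, `K'` totally complex, `K' = K(x)` with `x ∈ 𝓞_{K'}`, `x² = m ∈ 𝓞_K ∖ 0`: `μ₂ = 0` for the cyclotomic `ℤ₂`-extensions of `K`
  ⟹ `μ₂ = 0` for the cyclotomic `ℤ₂`-extensions of `K'` (intrinsic form: no surjectivity data in the statement).

Intended use (cell bsd-2adic): `K = ℚ(e₁)` the cubic field of a `2`-torsion abscissa of `E/ℚ` with `Δ_E < 0`, `K' = ℚ(E[2]) = K(e₂ − e₃)`.

References: [Iwasawa1973MuInvariants] Thm. 2/3; [Washington1997] §13; [NeukirchANT1999] Ch. I §8, Ch. III §3.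
-/

set_option autoImplicit false

noncomputable section

open scoped NumberField Polynomial IntermediateField
open NumberField Field Polynomial

namespace Literature.NumberTheory.IwasawaTheory

open Literature.NumberTheory.EllipticCurves Literature.NumberTheory.EllipticCurves.ZpExtension
  Literature.NumberTheory.GaloisRepresentations

/-- A totally complex number field has no ring morphism to `ℝ`. [folklore] -/
private theorem false_of_ringHom_real {K' : Type} [Field K'] [NumberField K'] [IsTotallyComplex K'] (ρ : K' →+* ℝ) : False := by
  have h : ComplexEmbedding.IsReal (Complex.ofRealHom.comp ρ) := by
    rw [ComplexEmbedding.isReal_iff]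
    ext x
    simp [ComplexEmbedding.conjugate_coe_eq]
  exact IsTotallyComplex.complexEmbedding_not_isReal _ h

open scoped Classical in
/-- A number field of odd degree has a ring morphism to `ℝ` (a real place). [cite: NeukirchANT1999, Ch. I §5 (r₁ + 2r₂ = n)] -/
private theorem nonempty_ringHom_real_of_odd {K : Type} [Field K] [NumberField K] (hodd : Odd (Module.finrank ℚ K)) :
    Nonempty (K →+* ℝ) := by
  have h := InfinitePlace.nrRealPlaces_pos_of_odd_finrank hodd
  obtain ⟨⟨w, hw⟩⟩ := Fintype.card_pos_iff.mp h
  exact ⟨InfinitePlace.embedding_of_isReal hw⟩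

/-- There is no rational square root of `2`. [folklore] -/
private theorem rat_sq_ne_two (q : ℚ) : q ^ 2 ≠ 2 := by
  intro hq
  have h : Real.sqrt 2 = ((|q| : ℚ) : ℝ) := by
    have hq' : ((q : ℝ)) ^ 2 = 2 := by exact_mod_cast hq
    rw [← hq', Real.sqrt_sq_eq_abs, Rat.cast_abs]
  exact irrational_sqrt_two.ne_rat |q| h

/-- **`[K(x) : K] = 2` for `x² ∈ K` when `K(x)` is totally complex and `[K : ℚ]` is odd** (`≤ 2` by the minimal polynomial of `x`;
`≠ 1` since `K` has a real place and `K(x)` has none). [cite: NeukirchANT1999, Ch. I §5 and §8] -/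
theorem finrank_eq_two_of_sq_eq_of_isTotallyComplex (K K' : Type) [Field K] [NumberField K] [Field K'] [NumberField K'] [Algebra K K']
    [IsTotallyComplex K'] (hodd : Odd (Module.finrank ℚ K)) {x : K'} {m : K} (hx : x ^ 2 = algebraMap K K' m)
    (hgen : Algebra.adjoin K {x} = ⊤) : Module.finrank K K' = 2 := by
  haveI : FiniteDimensional K K' := Module.Finite.of_restrictScalars_finite ℚ K K'
  have hint : IsIntegral K x := IsIntegral.of_finite K x
  have htop : K⟮x⟯ = ⊤ := by
    apply IntermediateField.toSubalgebra_injective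
    rw [IntermediateField.adjoin_simple_toSubalgebra_of_isAlgebraic hint.isAlgebraic, hgen, IntermediateField.top_toSubalgebra]
  have hfin : Module.finrank K K' = (minpoly K x).natDegree := by
    rw [← IntermediateField.adjoin.finrank hint, htop, IntermediateField.finrank_top']
  have hle : (minpoly K x).natDegree ≤ 2 := by
    have hp : (X ^ 2 - C m : K[X]) ≠ 0 := X_pow_sub_C_ne_zero two_pos m
    have hroot : aeval x (X ^ 2 - C m : K[X]) = 0 := by simp [hx]
    have h := natDegree_le_natDegree (minpoly.degree_le_of_ne_zero K x hp hroot)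
    rwa [natDegree_X_pow_sub_C] at h
  have hne : Module.finrank K K' ≠ 1 := by
    intro h1
    obtain ⟨σ⟩ := nonempty_ringHom_real_of_odd hodd
    have hbt : (⊥ : IntermediateField K K') = ⊤ := IntermediateField.bot_eq_top_iff_finrank_eq_one.mpr h1
    have hsurj : Function.Surjective (algebraMap K K') := fun y ↦ by
      have hy : y ∈ (⊥ : IntermediateField K K') := by rw [hbt]; trivial
      exact IntermediateField.mem_bot.mp hy
    let e := RingEquiv.ofBijective (algebraMap K K') ⟨(algebraMap K K').injective, hsurj⟩
    exact false_of_ringHom_real (σ.comp e.symm.toRingHom)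
  have hpos : 0 < Module.finrank K K' := Module.finrank_pos
  omega

/-- **`κ ∘ res_{K(x)}` is onto for the cyclotomic `ℤ₂`-extension `κ` of `ℚ`** when `x² ∈ K`, `K(x)` is totally complex and `[K : ℚ]` is odd:
`4 ∤ [K(x) : ℚ] = 2·[K : ℚ]`, so by the tree's dichotomy the alternative is `√2 ∈ K(x)`; `√2 ∈ K` contradicts `[K : ℚ]` odd, and
`√2 ∈ K(x) ∖ K` forces `K(x) = K(√2)`, which has a real place above a real place of `K`. [cite: Washington1997, §13.1 (ℚ_∞ ∩ K)]
[cite: NeukirchANT1999, Ch. I §8] -/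
theorem surjective_comp_absGaloisRestrict_of_sq_eq_of_isTotallyComplex (κ : ZpExtension ℚ 2) (hκ : κ.IsCyclotomic)
    (K K' : Type) [Field K] [NumberField K] [Field K'] [NumberField K'] [Algebra K K'] [IsTotallyComplex K']
    (hodd : Odd (Module.finrank ℚ K)) {x : K'} {m : K} (hx : x ^ 2 = algebraMap K K' m) (hgen : Algebra.adjoin K {x} = ⊤) :
    Function.Surjective (κ.toContinuousMonoidHom.comp (absGaloisRestrict ℚ K')) := by
  haveI : Fact (Nat.Prime 2) := ⟨Nat.prime_two⟩
  haveI : FiniteDimensional K K' := Module.Finite.of_restrictScalars_finite ℚ K K'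
  have hdeg := finrank_eq_two_of_sq_eq_of_isTotallyComplex K K' hodd hx hgen
  have h4 : ¬ 4 ∣ Module.finrank ℚ K' := by
    rw [← Module.finrank_mul_finrank ℚ K K', hdeg]
    obtain ⟨k, hk⟩ := hodd
    rw [hk]; omega
  rcases surjective_comp_absGaloisRestrict_or_exists_sq_eq_two κ K' hκ h4 with h | ⟨y, hy⟩
  · exact h
  exfalso
  have hint : IsIntegral K y := IsIntegral.of_finite K y
  by_cases hyK : y ∈ (algebraMap K K').range
  · -- `√2 ∈ K`: then `2 ∣ [K : ℚ]`
    obtain ⟨k, rfl⟩ := hyK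
    have hk : k ^ 2 = 2 := by
      apply (algebraMap K K').injective
      rw [map_pow, hy, map_ofNat]
    have hkint : IsIntegral ℚ k := IsIntegral.of_finite ℚ k
    have hk2 : (minpoly ℚ k).natDegree = 2 := by
      apply le_antisymm
      · have hp : (X ^ 2 - C 2 : ℚ[X]) ≠ 0 := X_pow_sub_C_ne_zero two_pos 2
        have hroot : aeval k (X ^ 2 - C 2 : ℚ[X]) = 0 := by simp [hk]
        have h := natDegree_le_natDegree (minpoly.degree_le_of_ne_zero ℚ k hp hroot)
        rwa [natDegree_X_pow_sub_C] at h
      · rw [minpoly.two_le_natDegree_iff hkint]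
        rintro ⟨q, hq⟩
        apply rat_sq_ne_two q
        apply (algebraMap ℚ K).injective
        rw [map_pow, hq, hk, map_ofNat]
    have htower := Module.finrank_mul_finrank ℚ ℚ⟮k⟯ K
    rw [IntermediateField.adjoin.finrank hkint, hk2] at htower
    obtain ⟨c, hc⟩ := hodd
    omega
  · -- `√2 ∈ K' ∖ K`: `K' = K(√2)` has a real place
    obtain ⟨σ⟩ := nonempty_ringHom_real_of_odd hodd
    have h2le : 2 ≤ (minpoly K y).natDegree := (minpoly.two_le_natDegree_iff hint).mpr hyK
    have hdvd : minpoly K y ∣ X ^ 2 - C 2 :=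
      minpoly.dvd K y (by simp only [map_sub, map_pow, aeval_X, hy, map_ofNat, sub_self])
    have hmin : minpoly K y = X ^ 2 - C 2 := by
      symm
      refine eq_of_monic_of_dvd_of_natDegree_le (minpoly.monic hint) (monic_X_pow_sub_C (2 : K) two_ne_zero) hdvd ?_
      rw [natDegree_X_pow_sub_C]; exact h2le
    have htop : K⟮y⟯ = ⊤ := by
      apply IntermediateField.eq_of_le_of_finrank_eq le_top
      rw [IntermediateField.adjoin.finrank hint, hmin, natDegree_X_pow_sub_C, IntermediateField.finrank_top', hdeg]
    letI : Algebra K ℝ := σ.toAlgebra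
    have hroot : aeval (Real.sqrt 2) (minpoly K y) = 0 := by
      rw [hmin]
      simp only [map_sub, map_pow, aeval_X, map_ofNat, Real.sq_sqrt zero_le_two, sub_self]
    have hmem : Real.sqrt 2 ∈ (minpoly K y).aroots ℝ := by
      rw [mem_aroots]
      exact ⟨minpoly.ne_zero hint, hroot⟩
    let φ₀ : K⟮y⟯ →ₐ[K] ℝ := (IntermediateField.algHomAdjoinIntegralEquiv K hint).symm ⟨Real.sqrt 2, hmem⟩
    let e : K' ≃ₐ[K] K⟮y⟯ := IntermediateField.topEquiv.symm.trans (IntermediateField.equivOfEq htop.symm)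
    exact false_of_ringHom_real ((φ₀ : K⟮y⟯ →+* ℝ).comp (e : K' →+* K⟮y⟯))

/-- **Iwasawa's `μ₂ = 0` ascends `K(√m)/K` over `ℚ` — intrinsic form.** `K ⊆ K'` number fields with `[K : ℚ]` odd, `K` with at most
one real embedding, `K'` totally complex, `K' = K(x)` with `x ∈ 𝓞_{K'}`, `x² = m ∈ 𝓞_K`, `m ≠ 0`; `κ` a cyclotomic `ℤ₂`-extension of `ℚ`
(auxiliary). If `μ₂ = 0` for the cyclotomic `ℤ₂`-extensions of `K`, then `μ₂ = 0` for every cyclotomic `ℤ₂`-extension of `K'`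
(`[K' : K] = 2` and both `κ ∘ res` onto by the two preceding theorems; then `classicalMuVanishes_restrict_rat_of_sq_eq` and the
cyclotomic invariance of `μ = 0`). [cite: Iwasawa1973MuInvariants, Thm. 2 and Thm. 3, §4] [cite: Washington1997, §13.3 Prop. 13.23] -/
theorem classicalMu_of_sq_eq_of_odd_finrank (κ : ZpExtension ℚ 2) (hκ : κ.IsCyclotomic)
    (K K' : Type) [Field K] [NumberField K] [Field K'] [NumberField K'] [Algebra K K'] [IsTotallyComplex K']
    [Subsingleton (K →+* ℝ)] (hodd : Odd (Module.finrank ℚ K))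
    {x : 𝓞 K'} {m : 𝓞 K} (hm : m ≠ 0) (hx : x ^ 2 = algebraMap (𝓞 K) (𝓞 K') m) (hgen : Algebra.adjoin K {(x : K')} = ⊤)
    (hμ : ∀ κP : ZpExtension K 2, κP.IsCyclotomic → ClassicalMuVanishes κP) :
    ∀ κF : ZpExtension K' 2, κF.IsCyclotomic → ClassicalMuVanishes κF := by
  intro κF hκF
  haveI : Fact (Nat.Prime 2) := ⟨Nat.prime_two⟩
  have hx' : ((x : 𝓞 K') : K') ^ 2 = algebraMap K K' ((m : 𝓞 K) : K) := by
    have h := congrArg (fun z : 𝓞 K' ↦ (z : K')) hx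
    have e1 : (((x ^ 2 : 𝓞 K') : 𝓞 K') : K') = ((x : 𝓞 K') : K') ^ 2 := by push_cast; rfl
    have e2 : (((algebraMap (𝓞 K) (𝓞 K') m : 𝓞 K') : 𝓞 K') : K') = algebraMap K K' ((m : 𝓞 K) : K) := rfl
    rw [← e1, ← e2]
    exact h
  have hK : Function.Surjective (κ.toContinuousMonoidHom.comp (absGaloisRestrict ℚ K)) :=
    surjective_comp_absGaloisRestrict_of_not_dvd_finrank κ K (by have := Nat.odd_iff.mp hodd; omega)
  have hK' : Function.Surjective (κ.toContinuousMonoidHom.comp (absGaloisRestrict ℚ K')) :=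
    surjective_comp_absGaloisRestrict_of_sq_eq_of_isTotallyComplex κ hκ K K' hodd hx' hgen
  have hdeg : Module.finrank K K' = 2 := finrank_eq_two_of_sq_eq_of_isTotallyComplex K K' hodd hx' hgen
  have h1 : ClassicalMuVanishes (κ.restrict K hK) := hμ _ (isCyclotomic_restrict κ hκ K hK)
  have h2 : ClassicalMuVanishes (κ.restrict K' hK') :=
    classicalMuVanishes_restrict_rat_of_sq_eq κ hκ K K' hdeg hm hx hgen hK hK' h1
  exact (classicalMuVanishes_iff_of_isCyclotomic _ _ (isCyclotomic_restrict κ hκ _ hK') hκF).mp h2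

end Literature.NumberTheory.IwasawaTheory

end
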